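import Summits.Ventures.HodgeRepro2.T5WeightSpaces

/-!
# The weight decomposition `V = ⨁_χ V_χ` of a compact abelian group

Blind cell `pub-hodge-repro2`, seat p1 (gen 12), Tier-5 kernel support for the S4.7 row «the weights of
SO(2)» (P2′): for a compact abelian group `K` and a continuous finite-dimensional representation `π`,
the weight spaces of distinct characters are disjoint, every stable line lies in the weight space of its
weight, and the weight spaces of the weights occurring sum to `V`.

* `isEmpty_equiv_charRep_of_ne` — distinct characters give inequivalent one-dimensional
  representations (their characters differ);
* **`disjoint_weightSpace_of_ne`** — `V_χ ⊓ V_{χ'} = ⊥` for `χ ≠ χ'`;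
* `lineWeight` — the weight (as `K →* ℂˣ`) of an irreducible stable subspace of a commutative group
  (a line), with `le_weightSpace_lineWeight` (the line lies in its weight space), `continuous_lineWeight`,
  `norm_lineWeight_eq_one`;
* **`exists_weight_decomposition`** — an irreducible internal-direct-sum decomposition `S` of `V` into
  stable lines with weights `lineWeight`, such that `⨆_{W ∈ S} V_{lineWeight W} = ⊤`.

Honest scope (unchanged): compact abelian groups, finite-dimensional continuous representations; the
weights {3, 5, 7, …} of the infinite-dimensional π₃⁺ are not an instance ([C]).
-/

namespace Summit.Ventures.HodgeRepro2.T5WeightDecomposition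

open MeasureTheory T5SchurOrthogonality T5CompleteReducibility T5RestrictionRep T5SchurMathlib
  T5AbelianWeights T5WeightOrthogonality T5IsotypicCopies T5IsotypicDecomposition T5WeightSpaces

variable {K : Type*} [Group K]

/-- Distinct characters give inequivalent one-dimensional representations. -/
theorem isEmpty_equiv_charRep_of_ne {χ χ' : K →* ℂˣ} (h : χ ≠ χ') :
    IsEmpty ((toRep (charRep χ)).Equiv (toRep (charRep χ'))) := by
  refine ⟨fun e => h ?_⟩
  ext k
  have := T5Multiplicity.character_eq_of_equiv (charRep χ) (charRep χ') e k
  rw [character_charRep, character_charRep] at this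
  exact this.symm

variable {V : Type*} [NormedAddCommGroup V] [InnerProductSpace ℂ V] [FiniteDimensional ℂ V]
variable (π : K →* V →L[ℂ] V)

section disjoint

variable [TopologicalSpace K] [IsTopologicalGroup K] [MeasurableSpace K] [BorelSpace K]
  [CompactSpace K] [T2Space K]

/-- **Weight spaces of distinct characters are disjoint** (they are isotypic components of
inequivalent irreducibles). -/
theorem disjoint_weightSpace_of_ne (hπ : Continuous π) {χ χ' : K →* ℂˣ} (h : χ ≠ χ') :
    Disjoint (weightSpace π χ) (weightSpace π χ') := by
  obtain ⟨S, hS, hint⟩ := T5AveragedProjection.exists_isInternal_irreducible_of_compact π hπ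
  rw [← isotypic_charRep_eq_weightSpace, ← isotypic_charRep_eq_weightSpace]
  exact disjoint_isotypic_of_isInternal π S hint hS (charRep χ) (charRep χ')
    (isEmpty_equiv_charRep_of_ne h)

end disjoint

section lineWeight

variable [IsMulCommutative K]

/-- A non-zero vector of an irreducible stable subspace (chosen). -/
noncomputable def lineVector {W : Submodule ℂ V} (hW : IsIrreducibleSubspace π W) : V :=
  Classical.choose (Submodule.exists_mem_ne_zero_of_ne_bot hW.1)

omit [FiniteDimensional ℂ V] [IsMulCommutative K] in
/-- The chosen vector lies in `W`. -/
theorem lineVector_mem {W : Submodule ℂ V} (hW : IsIrreducibleSubspace π W) :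
    lineVector π hW ∈ W :=
  (Classical.choose_spec (Submodule.exists_mem_ne_zero_of_ne_bot hW.1)).1

omit [FiniteDimensional ℂ V] [IsMulCommutative K] in
/-- The chosen vector is non-zero. -/
theorem lineVector_ne_zero {W : Submodule ℂ V} (hW : IsIrreducibleSubspace π W) :
    lineVector π hW ≠ 0 :=
  (Classical.choose_spec (Submodule.exists_mem_ne_zero_of_ne_bot hW.1)).2

/-- The **weight** of an irreducible stable subspace of a commutative group (a line), as a
character `K →* ℂˣ`. -/
noncomputable def lineWeight {W : Submodule ℂ V} (hW : IsIrreducibleSubspace π W) : K →* ℂˣ :=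
  weightHom π hW.2.1 (finrank_eq_one_of_isIrreducibleSubspace π hW) (lineVector_mem π hW)
    (lineVector_ne_zero π hW)

/-- `π k` acts on the chosen vector by the weight. -/
theorem apply_lineVector {W : Submodule ℂ V} (hW : IsIrreducibleSubspace π W) (k : K) :
    π k (lineVector π hW) = ((lineWeight π hW k : ℂˣ) : ℂ) • lineVector π hW :=
  weight_spec π hW.2.1 (finrank_eq_one_of_isIrreducibleSubspace π hW) (lineVector_mem π hW)
    (lineVector_ne_zero π hW) k

/-- An irreducible stable subspace lies in the weight space of its weight. -/
theorem le_weightSpace_lineWeight {W : Submodule ℂ V} (hW : IsIrreducibleSubspace π W) :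
    W ≤ weightSpace π (lineWeight π hW) := by
  intro x hx
  obtain ⟨c, hc⟩ := exists_eq_smul (finrank_eq_one_of_isIrreducibleSubspace π hW)
    (lineVector_mem π hW) (lineVector_ne_zero π hW) ⟨x, hx⟩
  have hx' : x = c • lineVector π hW := congrArg Subtype.val hc
  rw [mem_weightSpace, hx']
  intro k
  rw [map_smul, apply_lineVector, smul_comm]

/-- The weight of a line of a continuous representation is continuous. -/
theorem continuous_lineWeight [TopologicalSpace K] (hπ : Continuous π) {W : Submodule ℂ V}
    (hW : IsIrreducibleSubspace π W) : Continuous fun k => ((lineWeight π hW k : ℂˣ) : ℂ) :=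
  continuous_weight π hW.2.1 (finrank_eq_one_of_isIrreducibleSubspace π hW) (lineVector_mem π hW)
    (lineVector_ne_zero π hW) hπ

end lineWeight

section decomposition

variable [IsMulCommutative K] [TopologicalSpace K] [IsTopologicalGroup K] [MeasurableSpace K]
  [BorelSpace K] [CompactSpace K] [T2Space K]

/-- The weights of a continuous representation of a compact group are unimodular. -/
theorem norm_lineWeight_eq_one (hπ : Continuous π) {W : Submodule ℂ V}
    (hW : IsIrreducibleSubspace π W) (k : K) : ‖((lineWeight π hW k : ℂˣ) : ℂ)‖ = 1 :=
  T5UnimodularWeights.norm_weight_eq_one (haarProb K) π hπ hW.2.1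
    (finrank_eq_one_of_isIrreducibleSubspace π hW) (lineVector_mem π hW) (lineVector_ne_zero π hW) k

/-- **The weight decomposition**: `V` is an internal direct sum of stable lines `S`, each line `W`
lies in the weight space of its weight `lineWeight W` (a continuous unimodular character), and the
weight spaces of the occurring weights sum to `V`: `⨆_{W ∈ S} V_{lineWeight W} = ⊤`. -/
theorem exists_weight_decomposition (hπ : Continuous π) :
    ∃ S : Finset (Submodule ℂ V), ∃ hS : ∀ W ∈ S, IsIrreducibleSubspace π W,
      (∀ W ∈ S, Module.finrank ℂ W = 1) ∧
      DirectSum.IsInternal (fun W : S => (W : Submodule ℂ V)) ∧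
      (∀ W : S, (W : Submodule ℂ V) ≤ weightSpace π (lineWeight π (hS W W.2))) ∧
      (⨆ W : S, weightSpace π (lineWeight π (hS W W.2))) = ⊤ := by
  obtain ⟨S, hS, hint⟩ := T5AveragedProjection.exists_isInternal_irreducible_of_compact π hπ
  refine ⟨S, hS, fun W hW => finrank_eq_one_of_isIrreducibleSubspace π (hS W hW), hint,
    fun W => le_weightSpace_lineWeight π (hS W W.2), ?_⟩
  apply eq_top_iff.mpr
  rw [← hint.submodule_iSup_eq_top]
  exact iSup_mono fun W => le_weightSpace_lineWeight π (hS W W.2)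

end decomposition

end Summit.Ventures.HodgeRepro2.T5WeightDecomposition
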